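import Summits.Langlands.Langlands.Theses.IrreducibilityBySelfDuality
import Literature.NumberTheory.GaloisRepresentations.GlobalArtinMapNormProofs
import Literature.NumberTheory.GaloisRepresentations.SorensenPatching
import Mathlib.NumberTheory.NumberField.CMField

/-!
Sketch for crux-ideate stmt-Langlands-16722 (GaloisRepGL2CMae), ideator k=2, round 1.
First lemmas of the idea card `central-sign-kill`; nothing here is proved (statements only).
-/

open scoped NumberField
open NumberField IsDedekindDomain
open Literature.NumberTheory.GaloisRepresentations
open Literature.NumberTheory.Automorphic

namespace Summit.Langlands.Langlands.Cruxes.GaloisRepGL2CMae.Ideas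

/-- Card `central-sign-kill`, FIRST LEMMA (the lever; class-field-theory level).
`K/F` a CM extension (`F` totally real, `K` totally complex, `[K:F] = 2`), `ω` a finite-order Hecke
character of `K`.  If `ω` kills the idele `(-1)_v` of `F` (pushed into `𝕀_K`) for every FINITE place
`v` of `F`, then `ω = χ² · (ν ∘ N_{K/F})` with `χ`, `ν` Hecke characters of finite order.
(The converse is trivial: `χ²((-1)_v) = χ((-1)_v)² = 1`, `(ν∘N)((-1)_v) = ν((-1)_v²) = 1`; so the
local signs `ω((-1)_v) ∈ {±1}` are EXACTLY the obstruction to twisting `ω` into a character that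
factors through the norm — the hypothesis (Char) of Taylor / Harris–Soudry–Taylor / Mok.) -/
def CentralSignCriterion : Prop :=
  ∀ (F K : Type) [Field F] [NumberField F] [Field K] [NumberField K] [Algebra F K] [IsGalois F K],
    IsTotallyReal F → IsTotallyComplex K → Module.finrank F K = 2 →
    ∀ (ω : HeckeCharacter K), ω.IsFiniteOrder →
    (∀ v : HeightOneSpectrum (𝓞 F), ω (AdeleRing.ideleBaseChange F K (localUnits v (-1))) = 1) →
    ∃ (χ : HeckeCharacter K) (ν : HeckeCharacter F),
      χ.IsFiniteOrder ∧ ν.IsFiniteOrder ∧ ω = χ ^ 2 * ν.compRelNorm K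

/-- Card `central-sign-kill`, the form the LINE uses (no `K⁺`, no `ν`): `K` totally complex, `L/K`
Galois quadratic, `ω` a finite-order Hecke character of `K`.  If every finite place `w` of `K` with
`ω_w(-1) ≠ 1` has a SINGLE place of `L` above it (local degree `2`), then `ω ∘ N_{L/K}` is the SQUARE
of a finite-order Hecke character of `L`.  (Duality on `C_L/D_L`: `(2A)^⊥ = Γ_L[2]` = classes of sign
ideles `ε ∈ {±1}^{places}` (global square theorem + divisibility of `D_L`), and
`(ω∘N)(ε_u) = ω_w((-1)^{[L_u:K_w]})`; complex places contribute nothing.)  Over a member `L` the base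
change `σ_L` twisted by `χ⁻¹` then has central character EXACTLY `‖·‖^{-μ₀}` — condition (Char) of
Mok's theorem in its simplest instance (`MokNormCentralCharacter`). -/
def SquareUpstairs : Prop :=
  ∀ (K L : Type) [Field K] [NumberField K] [Field L] [NumberField L] [Algebra K L] [IsGalois K L],
    IsTotallyComplex K → Module.finrank K L = 2 →
    ∀ (ω : HeckeCharacter K), ω.IsFiniteOrder →
    (∀ w : HeightOneSpectrum (𝓞 K), ω (localUnits w (-1)) = 1 ∨
        ∀ u₁ u₂ : HeightOneSpectrum (𝓞 L),
          u₁.asIdeal.under (𝓞 K) = w.asIdeal → u₂.asIdeal.under (𝓞 K) = w.asIdeal → u₁ = u₂) →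
    ∃ χ : HeckeCharacter L, χ.IsFiniteOrder ∧ ω.compRelNorm L = χ ^ 2

/-- Card `central-sign-kill`: the local signs DIE in a quadratic CM extension `L = K·F'` (`F'/F` a
totally real quadratic extension) in which every BAD place `v` (one with `ω((-1)_v) = -1`) has a
single place of `F'` above it (local degree `2`): then `ω ∘ N_{L/K}` satisfies the hypothesis of
`CentralSignCriterion` over `L/F'`, because `(ω ∘ N_{L/K})|_{𝕀_{F'}} = ω|_{𝕀_F} ∘ N_{F'/F}` and
`N_{F'_u/F_v}(-1) = (-1)^{[F'_u : F_v]}`. -/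
def SignsDieUpstairs : Prop :=
  ∀ (F F' K L : Type) [Field F] [NumberField F] [Field F'] [NumberField F'] [Field K] [NumberField K]
    [Field L] [NumberField L] [Algebra F F'] [Algebra F K] [Algebra F L] [Algebra F' L] [Algebra K L]
    [IsScalarTower F K L] [IsScalarTower F F' L] [IsGalois F K] [IsGalois F' L] [IsGalois K L],
    IsTotallyReal F → IsTotallyReal F' → IsTotallyComplex K → IsTotallyComplex L →
    Module.finrank F K = 2 → Module.finrank F' L = 2 → Module.finrank K L = 2 →
    ∀ (ω : HeckeCharacter K), ω.IsFiniteOrder →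
    (∀ v : HeightOneSpectrum (𝓞 F),
        ω (AdeleRing.ideleBaseChange F K (localUnits v (-1))) = 1 ∨
        ∀ u₁ u₂ : HeightOneSpectrum (𝓞 F'),
          u₁.asIdeal.under (𝓞 F) = v.asIdeal → u₂.asIdeal.under (𝓞 F) = v.asIdeal → u₁ = u₂) →
    ∀ u : HeightOneSpectrum (𝓞 F'),
      (ω.compRelNorm L) (AdeleRing.ideleBaseChange F' L (localUnits u (-1))) = 1

/-- Card `central-sign-kill`, the APEX shape the line consumes (Mok, Compositio 150 (2014) =
arXiv:1109.5392, Thm. 1.1 at the unramified places, in the special case of condition (Char) with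
`ω̃ = |·|^{-m}`): for `L` CM and `σ` regular algebraic cuspidal on `GL₂(𝔸_L)` whose central character
is an integral power of the idelic norm (Satake shadow: `∏ β = q_w^m` wherever `σ` has a Satake
parameter `β`), there is a continuous `ρ : Γ_L → GL₂(ℚ̄_ℓ)` unramified, with the Satake–Frobenius
polynomial, at every place `w ∤ ℓ` where `σ` has a Satake parameter. -/
def MokNormCentralCharacter : Prop :=
  ∀ (L : Type) [Field L] [NumberField L], IsCMField L →
    ∀ (hcpt : isCompact_glFiniteIntegralLevel 2 L)
      (σ : CuspidalAutomorphicRepData 2 L hcpt), σ.1.IsRegularAlgebraic →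
    (∃ m : ℤ, ∀ (w : HeightOneSpectrum (𝓞 L)) (β : Multiset ℂ), σ.1.HasSatakeParamAt w β →
        β.prod = ((w.residueCard : ℂ)) ^ m) →
    ∀ (ℓ : ℕ) [Fact ℓ.Prime] (ι : PadicAlgCl ℓ ≃+* ℂ),
      ∃ ρ : FramedGaloisRep L (PadicAlgCl ℓ) 2,
        ∀ (w : HeightOneSpectrum (𝓞 L)) (β : Multiset ℂ), σ.1.HasSatakeParamAt w β →
          ((ℓ : ℕ) : 𝓞 L) ∉ w.asIdeal →
          ρ.IsUnramifiedAt w ∧ ρ.HasFrobCharpolyAt w (arithFrobPolyOfSatake ι w.residueCard 2 β)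

/-- Shape of the line (informal composition; the kernel-checked `GaloisRepGL2CMae_of` is the
crux-plan seat's business): sign criterion + signs die upstairs + the apex over each member of an
`S`-general family of quadratic CM extensions + Arthur–Clozel quadratic base change (the crux's own
leaf items 15021/15022) + finite-order twist bookkeeping + Sorensen patching (tree) ⇒ the crux,
named BY NAME as the target. -/
def LineShape : Prop :=
  SquareUpstairs → MokNormCentralCharacter →
    Summit.Langlands.Langlands.Theses.IrreducibilityBySelfDuality.ACStrongLiftingArchimedean →
    Summit.Langlands.Langlands.Theses.IrreducibilityBySelfDuality.ACStrongCuspidalBaseChangePrime →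
    Summit.Langlands.Langlands.Theses.IrreducibilityBySelfDuality.GaloisRepGL2CMae

end Summit.Langlands.Langlands.Cruxes.GaloisRepGL2CMae.Ideas
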